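import Literature.MathematicalPhysics.QuantumFieldTheory.Balaban1983to89.B9C2FormBoxRegimeY
import Literature.MathematicalPhysics.QuantumFieldTheory.Balaban1983to89.B9C2LettersRealSymm
import Literature.MathematicalPhysics.QuantumFieldTheory.Balaban1983to89.B9Eq332FieldAvgCovariance

/-!
# `Balaban1983to89.B9C2LettersTorusYCov` — [B9] (3.28) p. 395, (3.32)–(3.34) pp. 395–396 with [B7] (11) p. 19, (136) p. 39: **GAUGE COVARIANCE OF THE TORUS
# READING OF [5]'s `C_j⁽²⁾`** — the raw datum `rawFormY w` and the generated real-symmetric letter transform by CONJUGATION AT THE BLOCK CORNER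

T. Bałaban, *Propagators for lattice gauge theories in a background field*, Commun. Math. Phys. **99** (1985) 389–434 [`Balaban1985BackgroundPropagators`, "B9"];
[5] = [B7] = T. Bałaban, *Averaging operations for lattice gauge theories*, Commun. Math. Phys. **98** (1985) 17–51 [`Balaban1985Averaging`].
statement-level skeleton of published theorems with citation tags; proofs where landed; nothing here is a claim about the Yang–Mills mass gap.

THE PRINT.  [B9] p. 395 (3.28) *«(R(u)U′)(x, x′) = R(u(x))U′(x, x′)»*, (3.32) *«Q(U^u)R(u) = R(u)Q(U)»*, p. 396 *«inspecting the definitions of the averaging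
operators Q_j(U) for gauge fields we can see that the equalities (3.32) hold again. This implies the transformation laws (3.34)»*; [B7] (11) p. 19 (the averaging
commutes with gauge transformations restricted to the coarse lattice), (136) p. 39 (the Taylor terms `C_j⁽ⁿ⁾`).

WHY THIS FILE (seat dag-n06-l g34, programme P-C2, sequel (C3)).  def-Y's `Node00.OpsYDelta2Form.C2LettersY.IsCov` displays the covariance of the form letter
`C⁽²⁾`.  For the letter GENERATED from the torus reading (`B9C2LettersRealSymm.c2LettersOfRawY ∘ B9C2LettersTorusY.rawFormY`, def-Y's pin `c2YOfRecord`) this file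
proves what [B7]'s construction actually gives, UNCONDITIONALLY in `U`: the raw datum is covariant for EVERY invertible gauge function, the realified letter for
every UNITARY-valued one, the conjugation on the coarse bond `c` being by `u` AT THE CORNER `L^{j(c)}·z(c)` of the block `B^{j(c)}(c₋)` — [B7]'s convention for the
coarse lattices (`B7AvgGaugeCovariance.uLev`: `u_j(z) = u(Lʲz)`), which is [B9]'s (`T_{Lʲη} ⊂ T_η`, p. 390).  LOCATED (for def-Y): `IsCov` reads `u` at
`gIBondY g c = g (embIter j c₋)`, the iterated CENTRE embedding of `Setup.emb` (RG1 p. 251; `Setup` DIVERGENCE F3) — a different site; and it quantifies over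
non-unitary `g`, for which the REALIFIED letter is not covariant.  So `(c2YOfRecord …).IsCov` is not the statement proved here; `form_gauge_of_unitary` below is.

HOW.  `B9Eq332FieldAvgCovariance.logCovIter_rot ∕ linCovIter_rot` (dag-n06-w3: (121)∕(122) and their composites are covariant for EVERY background) give
`CCovIter_gauge_rot`; the second derivative at `0` of `v ↦ C_j(U₀^u, ins_S v)(c)` is transported through the continuous linear AUTOMORPHISMS «conjugate the box field
pointwise» and «conjugate the value» (`ContinuousLinearEquiv.comp_right_fderiv ∕ comp_fderiv`, no differentiability needed); the chart lemmas `readY_gaugeY`,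
`fieldY_conjY` move it to def-Y's carriers; `⋆` commutes with unitary conjugation for the realified letter.

WHAT THIS FILE PROVES (0 sorry).
* §1 (ℤᵈ) `CCovIter_gauge_rot`; `conjUnitCLE`, `conjUnitPiCLE` (conjugation as continuous linear automorphisms), `insCfg_conjUnitPi`, ★★ `snd_fderiv_CCovIter_ins_gauge_rot`, ★ `torusPol_gauge_rot`.
* §2 (chart) `srcCornerY`, `gSrcCornerY`, `readY_gaugeY`, `fieldY_conjY`, ★★ `rawPolY_gauge`, ★★ `rawFormY_gauge` (every invertible `g`, every `U`).
* §3 ★★★ `form_gauge_of_unitary` — `(c2LettersOfRawY i (rawFormY i w)).form (U^g) (R(g)A) (R(g)A′) = R(g∘corner)((…).form U A A′)` for unitary-valued `g`, EVERY `U`.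
NOT CLAIMED: def-Y's `C2LettersY.IsCov` (centre point, all invertible `g`) — see LOCATED above.
-/

noncomputable section

namespace Literature.MathematicalPhysics.QuantumFieldTheory.Balaban1983to89.B9C2LettersTorusYCov

open Node00 (CfgY FBondY IBondY GaugeY gaugeY gBondY conjY gaugeY_apply conjY_apply C2LettersY)
open B6KLevelCensusIndexV1 (KIdx)
open B6GlobalChartV1 (PV)
open B6Ineq2142KLevelV1 (lvl)
open B7Prop1Explicit (gaugeAct e)
open B7Eq78Linearization (conjR conjR_apply)
open B7AvgGaugeCovariance (uLev uLev_apply)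
open B7Prop3Flat (insCfg)
open B7Prop5GeneralInduction (CCovIter)
open B7AvgPeriodicity (proj)
open B7Eq136SecondOrderPeriodic (boxRead torusPol torusPol_apply boxRead_apply)
open B12Ineq417Flat (boxBonds)
open B9Eq332FieldAvgCovariance (logCovIter_rot linCovIter_rot)
open B9C2LettersTorusY (T0 readY fieldY zOf κOf rawPolY rawFormY rawPolY_apply rawFormY_apply readY_apply fieldY_apply)
open B9C2LettersRealSymm (c2LettersOfRawY c2LettersOfRawY_form realPart_apply symmPart_apply)
open B9C2FormBoxRegimeY (proj_add_e)
open B9Eq39Adjoint (R R_smul R_add)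
open B7Prop2Explicit (unitaryUnits)

/-! ## §1 On `ℤᵈ`: `C_j` and its second Taylor term are covariant, conjugation by `u_j(z) = u(Lʲz)` -/

section Zd

variable {d : ℕ} {𝔸 : Type*} [NormedRing 𝔸] [NormedAlgebra ℂ 𝔸] [CompleteSpace 𝔸]

/-- **`C_j(U₀^u, R(u)B)(z, κ) = R(u(Lʲz)) C_j(U₀, B)(z, κ)`** for EVERY `U₀`, `B`, invertible `u` — from the covariance of the non-linear and the linear composite
averages (Literature twin of the Summits-side `…T4Continuum.Spine.NE1p.B7AveragingPureGauge.CCovIter_rot`, which Literature cannot import).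
Private here (dag-lead WORDS 331 (i): the public statement is the Summits twin's). [cite: Balaban1985BackgroundPropagators, (3.32) pp.395–396] [cite: Balaban1985Averaging, (11) p.19, (150) p.40] -/
private theorem CCovIter_gauge_rot (L : ℕ) (u : B7Prop1Explicit.Site d → 𝔸ˣ) (U₀ : B7Prop1Explicit.Site d → Fin d → 𝔸ˣ) (B : B7Prop1Explicit.Site d → Fin d → 𝔸)
    (j : ℕ) (z : B7Prop1Explicit.Site d) (κ : Fin d) :
    CCovIter L (gaugeAct u U₀) (fun x κ => conjR (u x) (B x κ)) j z κ = conjR (uLev L u j z) (CCovIter L U₀ B j z κ) := by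
  unfold CCovIter
  rw [logCovIter_rot, linCovIter_rot, conjR_apply, conjR_apply, conjR_apply, mul_sub, sub_mul]

/-- conjugation `R(g) : a ↦ g a g⁻¹` by a unit as a continuous linear AUTOMORPHISM of `𝔸`. [cite: Balaban1985BackgroundPropagators, (3.28) p.395, bookkeeping] -/
def conjUnitCLE (g : 𝔸ˣ) : 𝔸 ≃L[ℂ] 𝔸 :=
  ContinuousLinearEquiv.equivOfInverse (ContinuousLinearMap.mulLeftRight ℂ 𝔸 (g : 𝔸) ((g⁻¹ : 𝔸ˣ) : 𝔸))
    (ContinuousLinearMap.mulLeftRight ℂ 𝔸 ((g⁻¹ : 𝔸ˣ) : 𝔸) (g : 𝔸))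
    (fun a => by simp only [ContinuousLinearMap.mulLeftRight_apply, ← mul_assoc, Units.inv_mul, one_mul, Units.inv_mul_cancel_right])
    (fun a => by simp only [ContinuousLinearMap.mulLeftRight_apply, ← mul_assoc, Units.mul_inv, one_mul, Units.mul_inv_cancel_right])

omit [CompleteSpace 𝔸] in
/-- `conjUnitCLE g a = R(g)a`. [cite: Balaban1985BackgroundPropagators, (3.28) p.395, bookkeeping] -/
@[simp] theorem conjUnitCLE_apply (g : 𝔸ˣ) (a : 𝔸) : conjUnitCLE g a = conjR g a := rfl

/-- pointwise conjugation of a box field `v : S → 𝔸` by `u` at the bonds' initial points, as a continuous linear automorphism.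
[cite: Balaban1985BackgroundPropagators, (3.28) p.395, bookkeeping] -/
def conjUnitPiCLE (S : Finset (B7Prop1Explicit.Site d × Fin d)) (u : B7Prop1Explicit.Site d → 𝔸ˣ) : (S → 𝔸) ≃L[ℂ] (S → 𝔸) :=
  ContinuousLinearEquiv.piCongrRight fun s : S => conjUnitCLE (u s.1.1)

omit [CompleteSpace 𝔸] in
/-- `conjUnitPiCLE`, evaluated. [cite: Balaban1985BackgroundPropagators, (3.28) p.395, bookkeeping] -/
@[simp] theorem conjUnitPiCLE_apply (S : Finset (B7Prop1Explicit.Site d × Fin d)) (u : B7Prop1Explicit.Site d → 𝔸ˣ) (v : S → 𝔸) (s : S) :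
    conjUnitPiCLE S u v s = conjR (u s.1.1) (v s) := rfl

omit [CompleteSpace 𝔸] in
/-- the insertion of a conjugated box field is the conjugated insertion (`R(u)0 = 0` off the box). [cite: Balaban1985Averaging, p.24, bookkeeping] -/
theorem insCfg_conjUnitPi (S : Finset (B7Prop1Explicit.Site d × Fin d)) (u : B7Prop1Explicit.Site d → 𝔸ˣ) (v : S → 𝔸) :
    insCfg S (conjUnitPiCLE S u v) = fun x κ => conjR (u x) (insCfg S v x κ) := by
  funext x κ
  unfold insCfg
  split_ifs with h
  · rfl
  · simp [conjR_apply]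

/-- transport of a second derivative at `0` through continuous linear automorphisms: `D²[C ∘ f ∘ M⁻¹](0)(Ma, Ma′) = C(D²f(0)(a, a′))` — no differentiability
hypothesis (both sides are transported values of `fderiv`). [folklore] -/
private theorem snd_fderiv_conj {E F : Type*} [NormedAddCommGroup E] [NormedSpace ℂ E] [NormedAddCommGroup F] [NormedSpace ℂ F]
    (M : E ≃L[ℂ] E) (C : F ≃L[ℂ] F) (f : E → F) (a a' : E) :
    fderiv ℂ (fderiv ℂ ((C ∘ f) ∘ M.symm)) 0 (M a) (M a') = C (fderiv ℂ (fderiv ℂ f) 0 a a') := by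
  -- first derivative: `w ↦ C ∘L Df(M⁻¹w) ∘L M⁻¹ = Φ (Df (M⁻¹ w))`, `Φ := M.arrowCongr C`
  have h1 : fderiv ℂ ((C ∘ f) ∘ M.symm) = (M.arrowCongr C ∘ fderiv ℂ f) ∘ M.symm := by
    funext w
    have hw : fderiv ℂ ((C ∘ f) ∘ M.symm) w = (fderiv ℂ (C ∘ f) (M.symm w)).comp (M.symm : E →L[ℂ] E) := M.symm.comp_right_fderiv
    have hc : fderiv ℂ (C ∘ f) (M.symm w) = (C : F →L[ℂ] F).comp (fderiv ℂ f (M.symm w)) := C.comp_fderiv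
    rw [hw, hc]
    ext x
    simp only [Function.comp_apply, ContinuousLinearMap.coe_comp, ContinuousLinearEquiv.coe_coe, ContinuousLinearEquiv.arrowCongr_apply]
  -- second derivative at `0`
  have h2 : fderiv ℂ ((M.arrowCongr C ∘ fderiv ℂ f) ∘ M.symm) 0 =
      (fderiv ℂ (M.arrowCongr C ∘ fderiv ℂ f) (M.symm 0)).comp (M.symm : E →L[ℂ] E) := M.symm.comp_right_fderiv
  have h3 : fderiv ℂ (M.arrowCongr C ∘ fderiv ℂ f) (M.symm 0) =
      (M.arrowCongr C : (E →L[ℂ] F) →L[ℂ] (E →L[ℂ] F)).comp (fderiv ℂ (fderiv ℂ f) (M.symm 0)) := (M.arrowCongr C).comp_fderiv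
  rw [h1, h2, h3, map_zero]
  simp only [ContinuousLinearMap.coe_comp, Function.comp_apply, ContinuousLinearEquiv.coe_coe, ContinuousLinearEquiv.arrowCongr_apply,
    ContinuousLinearEquiv.symm_apply_apply]

/-- ★★ **THE SECOND TAYLOR TERM IS COVARIANT**: `D²[C_j(U₀^u, ins_S ·)(z,κ)](0)(R(u)a, R(u)a′) = R(u(Lʲz)) D²[C_j(U₀, ins_S ·)(z,κ)](0)(a, a′)` — for EVERY
`U₀`, box `S`, `a, a′`, invertible `u` (no regime: the derivative is transported through continuous linear automorphisms).
[cite: Balaban1985BackgroundPropagators, (3.32)–(3.34) pp.395–396] [cite: Balaban1985Averaging, (136) p.39, (11) p.19] -/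
theorem snd_fderiv_CCovIter_ins_gauge_rot (L : ℕ) (u : B7Prop1Explicit.Site d → 𝔸ˣ) (U₀ : B7Prop1Explicit.Site d → Fin d → 𝔸ˣ)
    (S : Finset (B7Prop1Explicit.Site d × Fin d)) (j : ℕ) (z : B7Prop1Explicit.Site d) (κ : Fin d) (a a' : S → 𝔸) :
    fderiv ℂ (fderiv ℂ (fun v : S → 𝔸 => CCovIter L (gaugeAct u U₀) (insCfg S v) j z κ)) 0 (conjUnitPiCLE S u a) (conjUnitPiCLE S u a') =
      conjR (uLev L u j z) (fderiv ℂ (fderiv ℂ (fun v : S → 𝔸 => CCovIter L U₀ (insCfg S v) j z κ)) 0 a a') := by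
  set M : (S → 𝔸) ≃L[ℂ] (S → 𝔸) := conjUnitPiCLE S u with hM
  set C : 𝔸 ≃L[ℂ] 𝔸 := conjUnitCLE (uLev L u j z) with hC
  set f : (S → 𝔸) → 𝔸 := fun v => CCovIter L U₀ (insCfg S v) j z κ with hf
  -- the transformed function is `C ∘ f ∘ M⁻¹`
  have hf' : (fun v : S → 𝔸 => CCovIter L (gaugeAct u U₀) (insCfg S v) j z κ) = (C ∘ f) ∘ M.symm := by
    funext w
    have h := CCovIter_gauge_rot L u U₀ (insCfg S (M.symm w)) j z κ
    rw [← insCfg_conjUnitPi, ← hM, M.apply_symm_apply] at h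
    simpa only [Function.comp_apply, hf, hC, conjUnitCLE_apply] using h
  rw [hf', snd_fderiv_conj, hC, conjUnitCLE_apply]

variable (T : ℕ) [NeZero T]

/-- ★ **THE TORUS POLARISATION IS COVARIANT**: for a periodic gauge function `u = u_T ∘ proj`,
`P_c(U₀^u)(R(u)a, R(u)a′) = R(u(Lʲz)) P_c(U₀)(a, a′)` — EVERY `U₀`, `a, a′`, invertible `u_T`. [cite: Balaban1985BackgroundPropagators, (3.32)–(3.34) pp.395–396]
[cite: Balaban1985Averaging, (136) p.39, (11) p.19] -/
theorem torusPol_gauge_rot (L : ℕ) (uT : (Fin d → ZMod T) → 𝔸ˣ) (U₀ : B7Prop1Explicit.Site d → Fin d → 𝔸ˣ) (j : ℕ) (z : B7Prop1Explicit.Site d) (κ : Fin d)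
    (a a' : (Fin d → ZMod T) × Fin d → 𝔸) :
    torusPol T L (gaugeAct (fun x => uT (proj T x)) U₀) j z κ (fun p => conjR (uT p.1) (a p)) (fun p => conjR (uT p.1) (a' p)) =
      conjR (uT (proj T (((L : ℤ) ^ j) • z))) (torusPol T L U₀ j z κ a a') := by
  rw [torusPol_apply, torusPol_apply]
  have hb : ∀ a'' : (Fin d → ZMod T) × Fin d → 𝔸,
      boxRead T (boxBonds L j z κ) (fun p => conjR (uT p.1) (a'' p)) = conjUnitPiCLE (boxBonds L j z κ) (fun x => uT (proj T x)) (boxRead T (boxBonds L j z κ) a'') :=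
    fun _ => funext fun _ => rfl
  rw [hb a, hb a', snd_fderiv_CCovIter_ins_gauge_rot, uLev_apply]

end Zd

/-! ## §2 Through the chart: the raw datum is covariant, conjugation at the block CORNER -/

section Chart

variable {d ℓ : ℕ} {hd : 1 ≤ d + 1} {hL : Odd (ℓ + 1) ∧ 1 < ℓ + 1} {b₀ b₁ : ℝ}
variable (i : KIdx d ℓ hd hL b₀ b₁) {𝔸 : Type} [NormedRing 𝔸] [NormedAlgebra ℂ 𝔸] [CompleteSpace 𝔸]

/-- **the corner site of the block `B^{j(c)}(c₋)`** on the member torus: `proj (L^{j(c)}·z(c))` ([B7]'s∕[B9]'s representative of a coarse site; NOT `Setup.emb`'s centre).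
[cite: Balaban1985BackgroundPropagators, p.390 («T_{Lʲη} ⊂ T_η»), (3.12) p.392] [cite: Balaban1985Averaging, (7) p.19] -/
def srcCornerY (c : IBondY i) : Fin (d + 1) → ZMod (T0 i) := proj (T0 i) ((((ℓ + 1 : ℕ) : ℤ) ^ lvl i.hN i.D i.hk c) • zOf i c)

/-- `u` read on the coarse-bond carrier AT THE CORNER of the source block. [cite: Balaban1985BackgroundPropagators, (3.28) p.395, (3.12) p.392, dictionary] -/
def gSrcCornerY (g : GaugeY 𝔸 i) : IBondY i → 𝔸ˣ := fun c => g (srcCornerY i c)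

/-- `gSrcCornerY`, evaluated. [cite: Balaban1985BackgroundPropagators, (3.28) p.395, bookkeeping] -/
theorem gSrcCornerY_apply (g : GaugeY 𝔸 i) (c : IBondY i) : gSrcCornerY i g c = g (proj (T0 i) ((((ℓ + 1 : ℕ) : ℤ) ^ lvl i.hN i.D i.hk c) • zOf i c)) := rfl

/-- the ℤᵈ-reading of a gauge-transformed configuration is the gauge transform of the reading by the periodic gauge function `g ∘ proj`.
[cite: Balaban1985BackgroundPropagators, (3.28) p.395] [cite: Balaban1987RG1, (0.1) p.251 (dictionary)] -/
theorem readY_gaugeY (g : GaugeY 𝔸 i) (U : CfgY 𝔸 i) : readY i (gaugeY i g U) = gaugeAct (fun z => g (proj (T0 i) z)) (readY i U) := by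
  funext z μ
  rw [readY_apply, gaugeY_apply, ← proj_add_e]
  rfl

/-- the field chart of `R(u)A` is the pointwise conjugate of the field chart. [cite: Balaban1985BackgroundPropagators, (3.28) p.395, bookkeeping] -/
theorem fieldY_conjY (g : GaugeY 𝔸 i) (A : FBondY i → 𝔸) : fieldY i (conjY (gBondY i g) A) = fun p => conjR (g p.1) (fieldY i A p) := rfl

/-- ★★ **`P_c` THROUGH THE CHART IS COVARIANT**: `rawPolY (U^g) c (R(g)A) (R(g)A′) = R(g(corner c)) (rawPolY U c A A′)` — EVERY `U`, `A, A′`, invertible `g`.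
[cite: Balaban1985BackgroundPropagators, (3.32)–(3.34) pp.395–396] [cite: Balaban1985Averaging, (136) p.39, (11) p.19] -/
theorem rawPolY_gauge (g : GaugeY 𝔸 i) (U : CfgY 𝔸 i) (c : IBondY i) (A A' : FBondY i → 𝔸) :
    rawPolY i (gaugeY i g U) c (conjY (gBondY i g) A) (conjY (gBondY i g) A') = conjR (gSrcCornerY i g c) (rawPolY i U c A A') := by
  rw [rawPolY_apply, rawPolY_apply, readY_gaugeY, fieldY_conjY, fieldY_conjY, torusPol_gauge_rot]
  rfl

/-- ★★ **THE RAW DATUM IS COVARIANT, conjugation at the block corner**: `rawFormY w (U^g) (R(g)A) (R(g)A′) = R(g∘corner)(rawFormY w U A A′)` — EVERY `U`, `A, A′`,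
weights `w`, invertible `g`. [cite: Balaban1985BackgroundPropagators, (3.34) p.396, p.421] [cite: Balaban1985Averaging, (136) p.39, (11) p.19] -/
theorem rawFormY_gauge (w : IBondY i → ℂ) (g : GaugeY 𝔸 i) (U : CfgY 𝔸 i) (A A' : FBondY i → 𝔸) :
    rawFormY i w (gaugeY i g U) (conjY (gBondY i g) A) (conjY (gBondY i g) A') = conjY (gSrcCornerY i g) (rawFormY i w U A A') := by
  funext c
  rw [rawFormY_apply, conjY_apply, rawFormY_apply, rawPolY_gauge, R_smul]
  rfl

end Chart

/-! ## §3 The generated real-symmetric letter is covariant for UNITARY-valued gauge functions -/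

section Letter

/-- `(R(u)a)⋆ = R(u)(a⋆)` for unitary `u`. [cite: Balaban1985Averaging, (22)–(23) p.21, bookkeeping] -/
theorem star_R_of_mem_unitaryUnits {𝔹 : Type*} [NormedRing 𝔹] [StarRing 𝔹] {u : 𝔹ˣ} (hu : u ∈ unitaryUnits 𝔹) (a : 𝔹) :
    star (R u a) = R u (star a) := by
  have hu' : (u : 𝔹) ∈ unitary 𝔹 := hu
  have hinv : ((u⁻¹ : 𝔹ˣ) : 𝔹) = star (u : 𝔹) := Units.inv_eq_of_mul_eq_one_right (Unitary.mul_star_self_of_mem hu')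
  rw [B9Eq39Adjoint.R_def, B9Eq39Adjoint.R_def, hinv, star_mul, star_mul, star_star, mul_assoc]

variable {d ℓ : ℕ} {hd : 1 ≤ d + 1} {hL : Odd (ℓ + 1) ∧ 1 < ℓ + 1} {b₀ b₁ : ℝ}
variable (i : KIdx d ℓ hd hL b₀ b₁) {𝔸 : Type} [NormedRing 𝔸] [NormedAlgebra ℂ 𝔸] [CompleteSpace 𝔸] [StarRing 𝔸]

omit [CompleteSpace 𝔸] in
/-- `(R(γ)Λ)⋆ = R(γ)(Λ⋆)` pointwise, for unitary-valued `γ`. [cite: Balaban1985Averaging, (22)–(23) p.21, bookkeeping] -/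
theorem star_conjY_of_unitary {X : Type} [Fintype X] {γ : X → 𝔸ˣ} (hγ : ∀ x, γ x ∈ unitaryUnits 𝔸) (Λ : X → 𝔸) :
    star (conjY γ Λ) = conjY γ (star Λ) := by
  funext x
  rw [Pi.star_apply, conjY_apply, conjY_apply, star_R_of_mem_unitaryUnits (hγ x), Pi.star_apply]

variable [StarModule ℂ 𝔸]

/-- ★★★ **COVARIANCE OF THE GENERATED LETTER, UNITARY GAUGE FUNCTIONS, EVERY BACKGROUND**: for `g` with values in `U(𝔸)`,
`(c2LettersOfRawY i (rawFormY i w)).form (U^g) (R(g)A) (R(g)A′) = R(g∘corner) ((c2LettersOfRawY i (rawFormY i w)).form U A A′)` — realification and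
symmetrisation commute with unitary conjugation. (def-Y's `C2LettersY.IsCov` reads `g` at `gIBondY` = the iterated block CENTRE and allows non-unitary `g`: not this
statement.) [cite: Balaban1985BackgroundPropagators, (3.34) p.396, (3.134) p.422] [cite: Balaban1985Averaging, (11) p.19, (22)–(23) p.21, (136) p.39] -/
theorem form_gauge_of_unitary (w : IBondY i → ℂ) {g : GaugeY 𝔸 i} (hg : ∀ x, g x ∈ unitaryUnits 𝔸) (U : CfgY 𝔸 i) (A A' : FBondY i → 𝔸) :
    (c2LettersOfRawY i (rawFormY i w)).form (gaugeY i g U) (conjY (gBondY i g) A) (conjY (gBondY i g) A') =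
      conjY (gSrcCornerY i g) ((c2LettersOfRawY i (rawFormY i w)).form U A A') := by
  have hgB : ∀ b : FBondY i, gBondY i g b ∈ unitaryUnits 𝔸 := fun b => hg _
  have hgC : ∀ c : IBondY i, gSrcCornerY i g c ∈ unitaryUnits 𝔸 := fun c => hg _
  simp only [c2LettersOfRawY_form, realPart_apply, symmPart_apply]
  rw [star_conjY_of_unitary hgB A, star_conjY_of_unitary hgB A']
  simp only [rawFormY_gauge, map_add, map_smul, ← star_conjY_of_unitary hgC]

end Letter

end Literature.MathematicalPhysics.QuantumFieldTheory.Balaban1983to89.B9C2LettersTorusYCov
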